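import Literature.Computability.AlgebraicComplexity.LMR13DualVarieties
import Literature.Computability.AlgebraicComplexity.LMRDetIdealModuleWeight
import Literature.Computability.AlgebraicComplexity.LMRDetIdealModuleProofs
import Literature.Computability.AlgebraicComplexity.LMR13SubspaceTangentExcess
import Literature.Computability.AlgebraicComplexity.LMR13ZariskiTangentProofs
import HarnessLib

/-!
# `GL(W)`-equivariance of the LMR equations; invariance of `𝒟ual_{k,d,N}` and of its Zariski tangent spaces

Landsberg–Manivel–Ressayre 2013, §2.3–§3.3: the equations `E_{B,u,v}` of §2.3 ("depending … on the
choice of a plane `L` in `W` and a line `D` in `L`", and of the `(k+3)`-plane `F`) transform into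
each other under linear substitutions — `E_{B,u,v}(P ∘ M) = E_{BM, Mᵀu, Mᵀv}(P)`
(`lmrDualEquation_linSubst`, from the tree's `hessGenMinor_linSubst`, §2.3 eq. (5)); hence the scheme
`𝒟ual_{k,d,N}` is `End(W)`-stable (`linSubst_mem_lmrDualScheme`; §3.1: "`𝒟ual_{k,n,N}` … `GL(W)`
…-invariant", the equations forming a `GL(W)`-module, Thm. 2.3.1) and the affine Zariski tangent space
`T̂_{[P]}𝒟ual` is stable under the stabiliser of `P` (`linSubst_mem_lmrZariskiTangent_of_linSubst_eq`;
§3.4: `T̂_{[det_n]}` "is a `GL(E)×GL(F)`-submodule", arXiv `p0007.txt:L41–44`) — the module structure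
on which the immanant analysis of §3.4 (Prop. 3.4.2) operates.

Part 2 (cone property): `lmrRemainder_mul` (eq. (2) is bihomogeneous), `lmrDualEquation_C_mul`
(`E(cP) = c^{(k+3)+(e−d+1)} E(P)`), `smul_mem_lmrDualScheme`, `mem_lmrZariskiTangent_smul_iff`
(`T̂_{[cP]} = T̂_{[P]}`, `c ≠ 0`), and `linSubst_mem_lmrZariskiTangent_of_linSubst_eq_smul` — stability of
`T̂_{[P]}` under substitutions with `P ∘ M = c·P` (e.g. `GL(E)×GL(F)` on `det_n`).

Theorem-only; no definitions, no named facts. Honest framing: bookkeeping for the LMR13 §3 files;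
VP ≠ VNP is NOT proved and nothing here is progress on it.

## References

* [LandsbergManivelRessayre2013] Comment. Math. Helv. 88 (2013), §2.3 eq. (5), §3.1, §3.4 (pp. 473–479).
-/

noncomputable section

namespace Literature.Computability.AlgebraicComplexity

open MvPolynomial

section Equivariance

variable {σ : Type*} [Fintype σ] {A : Type*} [CommRing A]

/-- Base change of a linear substitution along a ring map (private copy of the tree's `map_linSubst`,
not imported to keep the closure small). [cite: Landsberg2017, §1.2] -/
private theorem map_linSubst'' {B : Type*} [CommRing B] (φ : A →+* B) (M : Matrix σ σ A)
    (P : MvPolynomial σ A) :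
    map φ (linSubst σ A M P) = linSubst σ B (M.map φ) (map φ P) := by
  rw [linSubst, linSubst, AlgHom.coe_mk]
  show map φ (aeval (fun i => ∑ j, M j i • X j) P) = aeval (fun i => ∑ j, M.map φ j i • X j) (map φ P)
  rw [aeval_eq_bind₁, aeval_eq_bind₁, map_bind₁]
  have hfg : (fun i => map φ (∑ j, M j i • (X j : MvPolynomial σ A))) =
      fun i => ∑ j, M.map φ j i • (X j : MvPolynomial σ B) := by
    funext i
    rw [map_sum]
    refine Finset.sum_congr rfl fun j _ => ?_
    rw [smul_eq_C_mul, smul_eq_C_mul, map_mul, map_C, map_X, Matrix.map_apply]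
  rw [hfg]

/-- **The binary restriction of a substituted form**: `(P ∘ M)|_{⟨u,v⟩} = P|_{⟨Mᵀu, Mᵀv⟩}`
(restricting `P(Mᵀx)` to the plane `x = s u + t v` is restricting `P` to the plane spanned by
`Mᵀu, Mᵀv`). [cite: LandsbergManivelRessayre2013, §2.2 (p. 473)] -/
theorem binRestr_linSubst (M : Matrix σ σ A) (u v : σ → A) (P : MvPolynomial σ A) :
    binRestr u v (linSubst σ A M P) =
      binRestr (fun i => ∑ j, M j i * u j) (fun i => ∑ j, M j i * v j) P := by
  rw [binRestr, binRestr, linSubst, AlgHom.coe_mk]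
  show aeval _ (aeval (fun i => ∑ j, M j i • X j) P) = _
  rw [← AlgHom.comp_apply, comp_aeval]
  have hfg : (fun i => aeval (fun i => C (u i) * X 0 + C (v i) * X 1 : σ → MvPolynomial (Fin 2) A)
      (∑ j, M j i • (X j : MvPolynomial σ A))) =
      fun i => C (∑ j, M j i * u j) * (X 0 : MvPolynomial (Fin 2) A) + C (∑ j, M j i * v j) * X 1 := by
    funext i
    rw [map_sum, map_sum, map_sum, Finset.sum_mul, Finset.sum_mul, ← Finset.sum_add_distrib]
    refine Finset.sum_congr rfl fun j _ => ?_
    rw [map_smul, aeval_X, smul_add, smul_eq_C_mul, smul_eq_C_mul, map_mul, map_mul, mul_assoc,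
      mul_assoc]
  rw [hfg]

/-- `p_j((P ∘ M)|_{⟨u,v⟩}) = p_j(P|_{⟨Mᵀu,Mᵀv⟩})`. [cite: LandsbergManivelRessayre2013, §2.2 (p. 473)] -/
theorem binCoeff_linSubst (d : ℕ) (M : Matrix σ σ A) (u v : σ → A) (P : MvPolynomial σ A) :
    binCoeff d u v (linSubst σ A M P) =
      binCoeff d (fun i => ∑ j, M j i * u j) (fun i => ∑ j, M j i * v j) P := by
  funext j
  rw [binCoeff, binCoeff, binRestr_linSubst]

/-- **Equivariance of the equations of §2.3**: `E_{B,u,v}(P ∘ M) = E_{BM, Mᵀu, Mᵀv}(P)` — the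
generalised Hessian minor transforms by `hessGenMinor_linSubst` (§2.3 eq. (5)) and the binary
restrictions by `binRestr_linSubst`. [cite: LandsbergManivelRessayre2013, §2.3 eq. (5) (p. 474)] -/
theorem lmrDualEquation_linSubst (κ d : ℕ) (B : Matrix (Fin (κ + 3)) σ A) (u v : σ → A)
    (M : Matrix σ σ A) (P : MvPolynomial σ A) :
    lmrDualEquation κ d B u v (linSubst σ A M P) =
      lmrDualEquation κ d (B * M) (fun i => ∑ j, M j i * u j) (fun i => ∑ j, M j i * v j) P := by
  unfold lmrDualEquation
  rw [hessGenMinor_linSubst, binCoeff_linSubst, binCoeff_linSubst]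

/-- **`𝒟ual_{k,d,N}` is stable under all linear substitutions** (`End(W)`, in particular `GL(W)`):
LMR §3.1 (the equations span a `GL(W)`-module, Thm. 2.3.1, so their common zero set is invariant).
[cite: LandsbergManivelRessayre2013, §3.1 (p. 476)] -/
theorem linSubst_mem_lmrDualScheme {κ d : ℕ} {P : MvPolynomial σ ℂ} (hP : P ∈ lmrDualScheme κ d)
    (M : Matrix σ σ ℂ) : linSubst σ ℂ M P ∈ lmrDualScheme κ d :=
  ⟨linSubst_isHomogeneous M hP.1, fun B u v => by rw [lmrDualEquation_linSubst]; exact hP.2 _ _ _⟩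

/-- The first-order deformation commutes with substitutions fixing `P`:
`(P + επ) ∘ M = P + ε (π ∘ M)` when `P ∘ M = P`. [cite: LandsbergManivelRessayre2013, §3.3 (p. 477)] -/
theorem linSubst_firstOrderDeformation {P π : MvPolynomial σ ℂ} (M : Matrix σ σ ℂ)
    (hM : linSubst σ ℂ M P = P) :
    linSubst σ (Polynomial ℂ) (M.map (Polynomial.C : ℂ →+* Polynomial ℂ)) (firstOrderDeformation P π) =
      firstOrderDeformation P (linSubst σ ℂ M π) := by
  rw [firstOrderDeformation, firstOrderDeformation, map_add, map_mul, linSubst_C,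
    ← map_linSubst'', ← map_linSubst'', hM]

/-- **The Zariski tangent space `T̂_{[P]}𝒟ual_{k,d,N}` is stable under the stabiliser of `P`**: if
`P ∘ M = P` then `π ∈ T̂_{[P]} ⟹ π ∘ M ∈ T̂_{[P]}` (differentiate the equivariance
`E_{B,u,v}((P+επ) ∘ M) = E_{BM,Mᵀu,Mᵀv}(P+επ)`). For `P = det_n` and `M` in the image of
`GL(E) × GL(F)` this is "`T̂_{[det_n]}𝒟ual_{2n−2,n,n²}` is a `GL(E)×GL(F)`-submodule" of §3.4.
[cite: LandsbergManivelRessayre2013, §3.4 (p. 478)] -/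
theorem linSubst_mem_lmrZariskiTangent_of_linSubst_eq {κ d : ℕ} {P π : MvPolynomial σ ℂ}
    (M : Matrix σ σ ℂ) (hM : linSubst σ ℂ M P = P) (hπ : π ∈ lmrZariskiTangent κ d P) :
    linSubst σ ℂ M π ∈ lmrZariskiTangent κ d P := by
  refine ⟨linSubst_isHomogeneous M hπ.1, fun B u v => ?_⟩
  rw [← linSubst_firstOrderDeformation M hM, lmrDualEquation_linSubst]
  have hB : B.map (Polynomial.C : ℂ →+* Polynomial ℂ) * M.map (Polynomial.C : ℂ →+* Polynomial ℂ) =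
      (B * M).map (Polynomial.C : ℂ →+* Polynomial ℂ) := by
    rw [Matrix.map_mul]
  have hu : (fun i => ∑ j, M.map (Polynomial.C : ℂ →+* Polynomial ℂ) j i * Polynomial.C (u j)) =
      fun i => Polynomial.C (∑ j, M j i * u j) := by
    funext i
    rw [map_sum]
    exact Finset.sum_congr rfl fun j _ => by rw [Matrix.map_apply, ← map_mul]
  have hv : (fun i => ∑ j, M.map (Polynomial.C : ℂ →+* Polynomial ℂ) j i * Polynomial.C (v j)) =
      fun i => Polynomial.C (∑ j, M j i * v j) := by
    funext i
    rw [map_sum]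
    exact Finset.sum_congr rfl fun j _ => by rw [Matrix.map_apply, ← map_mul]
  rw [hB, hu, hv]
  exact hπ.2 (B * M) _ _

/-- In particular for `GL(W)`: `g ∈ GL(W)` with `g·P = P` maps `T̂_{[P]}𝒟ual` into itself
(`linSubstRep` form). [cite: LandsbergManivelRessayre2013, §3.4 (p. 478)] -/
theorem linSubstRep_mem_lmrZariskiTangent_of_linSubstRep_eq [DecidableEq σ] {κ d : ℕ}
    {P π : MvPolynomial σ ℂ} (g : GL σ ℂ) (hg : linSubstRep σ ℂ g P = P) (hπ : π ∈ lmrZariskiTangent κ d P) :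
    linSubstRep σ ℂ g π ∈ lmrZariskiTangent κ d P := by
  rw [linSubstRep_apply] at hg ⊢
  exact linSubst_mem_lmrZariskiTangent_of_linSubst_eq _ hg hπ

/-- The first-order deformation commutes with substitutions, in general:
`(P + επ) ∘ M = P ∘ M + ε (π ∘ M)`. [cite: LandsbergManivelRessayre2013, §3.3 (p. 477)] -/
theorem linSubst_firstOrderDeformation' (P π : MvPolynomial σ ℂ) (M : Matrix σ σ ℂ) :
    linSubst σ (Polynomial ℂ) (M.map (Polynomial.C : ℂ →+* Polynomial ℂ)) (firstOrderDeformation P π) =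
      firstOrderDeformation (linSubst σ ℂ M P) (linSubst σ ℂ M π) := by
  rw [firstOrderDeformation, firstOrderDeformation, map_add, map_mul, linSubst_C,
    ← map_linSubst'', ← map_linSubst'']

end Equivariance

/-! ### The cone property: `E_{B,u,v}(cP) = c^{(k+3) + (e−d+1)} E_{B,u,v}(P)` -/

section Cone

variable {σ : Type*} [Fintype σ] {A : Type*} [CommRing A]

omit [Fintype σ] in
/-- **The remainder equation (2) is bihomogeneous**: linear in the `q`'s and of degree `e − d + 1` in
the `p`'s ("linear in the coefficients of `Q_L`, and of degree `e − d + 1` in those of `P_L`",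
arXiv `p0004.txt:L95`). [cite: LandsbergManivelRessayre2013, §2.2 eq. (2) (p. 473)] -/
theorem lmrRemainder_mul (d e : ℕ) (a b : A) (p q : ℕ → A) :
    lmrRemainder d e (fun i => a * p i) (fun i => b * q i) =
      b * a ^ (e - d + 1) * lmrRemainder d e p q := by
  classical
  unfold lmrRemainder
  rw [Finset.mul_sum]
  refine Finset.sum_congr rfl fun i _ => ?_
  have key : ∀ r ∈ Finset.range (e - d + 2),
      (-1 : A) ^ r * (a * p d) ^ (e - d + 1 - r) *
        (∑ j ∈ (Finset.univ : Finset (Fin r → Fin d)) with (∑ l, ((j l : ℕ) + 1)) + d = i + 1,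
          ∏ l, (a * p (d - ((j l : ℕ) + 1)))) =
      a ^ (e - d + 1) * ((-1 : A) ^ r * p d ^ (e - d + 1 - r) *
        ∑ j ∈ (Finset.univ : Finset (Fin r → Fin d)) with (∑ l, ((j l : ℕ) + 1)) + d = i + 1,
          ∏ l, p (d - ((j l : ℕ) + 1))) := by
    intro r hr
    rw [Finset.mem_range] at hr
    have hsum : (∑ j ∈ (Finset.univ : Finset (Fin r → Fin d)) with (∑ l, ((j l : ℕ) + 1)) + d = i + 1,
          ∏ l, (a * p (d - ((j l : ℕ) + 1)))) =
        a ^ r * ∑ j ∈ (Finset.univ : Finset (Fin r → Fin d)) with (∑ l, ((j l : ℕ) + 1)) + d = i + 1,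
          ∏ l, p (d - ((j l : ℕ) + 1)) := by
      rw [Finset.mul_sum]
      refine Finset.sum_congr rfl fun j _ => ?_
      rw [Finset.prod_mul_distrib, Finset.prod_const, Finset.card_univ, Fintype.card_fin]
    have hpow : a ^ (e - d + 1 - r) * a ^ r = a ^ (e - d + 1) := by
      rw [← pow_add, Nat.sub_add_cancel (by omega)]
    rw [hsum, mul_pow, ← hpow]
    ring
  rw [Finset.sum_congr rfl key, ← Finset.mul_sum]
  ring

/-- **The equations of §2.3 are homogeneous in `P`**: `E_{B,u,v}(c·P) = c^{k+3} · c^{e−d+1} · E_{B,u,v}(P)`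
with `e = (k+3)(d−2)` (the minor `det(H_{cP}|_F) = c^{k+3} det(H_P|_F)` and eq. (2) is linear in
`Q`, of degree `e − d + 1` in `P`; total degree `(k+2)(d−1)`, Thm. 2.3.1).
[cite: LandsbergManivelRessayre2013, §2.3 (p. 473–474)] -/
theorem lmrDualEquation_C_mul (κ d : ℕ) (B : Matrix (Fin (κ + 3)) σ A) (u v : σ → A) (c : A)
    (P : MvPolynomial σ A) :
    lmrDualEquation κ d B u v (C c * P) =
      c ^ (κ + 3) * c ^ ((κ + 3) * (d - 2) - d + 1) * lmrDualEquation κ d B u v P := by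
  unfold lmrDualEquation
  rw [hessGenMinor_C_mul, ← map_pow]
  have h1 : binCoeff d u v (C c * P) = fun j => c * binCoeff d u v P j :=
    funext fun j => binCoeff_C_mul d u v c P j
  have h2 : binCoeff ((κ + 3) * (d - 2)) u v (C (c ^ (κ + 3)) * hessGenMinor B B P) =
      fun j => c ^ (κ + 3) * binCoeff ((κ + 3) * (d - 2)) u v (hessGenMinor B B P) j :=
    funext fun j => binCoeff_C_mul _ u v _ _ j
  rw [h1, h2, lmrRemainder_mul]

/-- **`𝒟ual_{k,d,N}` is a cone**: stable under scalars. [cite: LandsbergManivelRessayre2013, §3.1 (p. 476)] -/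
theorem smul_mem_lmrDualScheme {κ d : ℕ} {P : MvPolynomial σ ℂ} (hP : P ∈ lmrDualScheme κ d)
    (c : ℂ) : c • P ∈ lmrDualScheme κ d := by
  refine ⟨?_, fun B u v => ?_⟩
  · exact (homogeneousSubmodule σ ℂ d).smul_mem c hP.1
  · rw [smul_eq_C_mul, lmrDualEquation_C_mul, hP.2 B u v, mul_zero]

omit [Fintype σ] in
/-- `P + επ` rescaled: `cP + επ = c · (P + ε c⁻¹π)` for `c ≠ 0`. [folklore] -/
private theorem firstOrderDeformation_smul {P π : MvPolynomial σ ℂ} {c : ℂ} (hc : c ≠ 0) :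
    firstOrderDeformation (c • P) π =
      C (Polynomial.C c) * firstOrderDeformation P (c⁻¹ • π) := by
  rw [firstOrderDeformation, firstOrderDeformation, smul_eq_C_mul, smul_eq_C_mul, map_mul, map_mul,
    map_C, map_C, mul_add, ← mul_assoc, ← mul_assoc, mul_comm (C (Polynomial.C c)) (C Polynomial.X),
    mul_assoc (C Polynomial.X), ← map_mul, ← map_mul, ← map_mul, mul_inv_cancel₀ hc, map_one,
    mul_one]

/-- **The Zariski tangent space does not see the scaling of the base point**: `T̂_{[cP]} = T̂_{[P]}`
for `c ≠ 0` (the equations are homogeneous in `P`, `lmrDualEquation_C_mul`, and `T̂` is a linear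
subspace, `smul_add_smul_mem_lmrZariskiTangent`). [cite: LandsbergManivelRessayre2013, §3.3 (p. 477)] -/
theorem mem_lmrZariskiTangent_smul_iff [DecidableEq σ] {κ d : ℕ} {P π : MvPolynomial σ ℂ} {c : ℂ}
    (hc : c ≠ 0) : π ∈ lmrZariskiTangent κ d (c • P) ↔ π ∈ lmrZariskiTangent κ d P := by
  -- the key computation: the `ε`-coefficient at `cP` along `π` is `c^N` times that at `P` along `c⁻¹π`
  have key : ∀ (B : Matrix (Fin (κ + 3)) σ ℂ) (u v : σ → ℂ),
      (lmrDualEquation κ d (B.map (Polynomial.C : ℂ →+* Polynomial ℂ))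
        (fun i => Polynomial.C (u i)) (fun i => Polynomial.C (v i))
        (firstOrderDeformation (c • P) π)).coeff 1 =
      c ^ (κ + 3) * c ^ ((κ + 3) * (d - 2) - d + 1) *
        (lmrDualEquation κ d (B.map (Polynomial.C : ℂ →+* Polynomial ℂ))
          (fun i => Polynomial.C (u i)) (fun i => Polynomial.C (v i))
          (firstOrderDeformation P (c⁻¹ • π))).coeff 1 := by
    intro B u v
    rw [firstOrderDeformation_smul hc, lmrDualEquation_C_mul, ← map_pow, ← map_pow, ← map_mul,
      Polynomial.coeff_C_mul]
  have hcN : c ^ (κ + 3) * c ^ ((κ + 3) * (d - 2) - d + 1) ≠ 0 :=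
    mul_ne_zero (pow_ne_zero _ hc) (pow_ne_zero _ hc)
  constructor
  · intro h
    -- `c⁻¹π ∈ T̂_P`, hence `π = c • c⁻¹π ∈ T̂_P`
    have h' : c⁻¹ • π ∈ lmrZariskiTangent κ d P := by
      refine ⟨(homogeneousSubmodule σ ℂ d).smul_mem c⁻¹ h.1, fun B u v => ?_⟩
      have h2 := h.2 B u v
      rw [key] at h2
      exact (mul_eq_zero.mp h2).resolve_left hcN
    have := smul_add_smul_mem_lmrZariskiTangent h' (zero_mem_lmrZariskiTangent κ d P) c 0
    rwa [smul_smul, mul_inv_cancel₀ hc, one_smul, zero_smul, add_zero] at this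
  · intro h
    have h' : c⁻¹ • π ∈ lmrZariskiTangent κ d P := by
      simpa using smul_add_smul_mem_lmrZariskiTangent h (zero_mem_lmrZariskiTangent κ d P) c⁻¹ 0
    refine ⟨h.1, fun B u v => ?_⟩
    rw [key, h'.2 B u v, mul_zero]

/-- **`T̂_{[P]}𝒟ual` is stable under every substitution fixing `P` up to a non-zero scalar**
(`P ∘ M = c·P`, `c ≠ 0`): the form in which `GL(E)×GL(F)` (acting on `det_n` by `det A · det B`)
preserves `T̂_{[det_n]}𝒟ual_{2n−2,n,n²}` (§3.4). [cite: LandsbergManivelRessayre2013, §3.4 (p. 478)] -/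
theorem linSubst_mem_lmrZariskiTangent_of_linSubst_eq_smul [DecidableEq σ] {κ d : ℕ}
    {P π : MvPolynomial σ ℂ} (M : Matrix σ σ ℂ) {c : ℂ} (hc : c ≠ 0)
    (hM : linSubst σ ℂ M P = c • P) (hπ : π ∈ lmrZariskiTangent κ d P) :
    linSubst σ ℂ M π ∈ lmrZariskiTangent κ d P := by
  rw [← mem_lmrZariskiTangent_smul_iff hc]
  refine ⟨linSubst_isHomogeneous M hπ.1, fun B u v => ?_⟩
  rw [← hM, ← linSubst_firstOrderDeformation', lmrDualEquation_linSubst]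
  have hB : B.map (Polynomial.C : ℂ →+* Polynomial ℂ) * M.map (Polynomial.C : ℂ →+* Polynomial ℂ) =
      (B * M).map (Polynomial.C : ℂ →+* Polynomial ℂ) := by
    rw [Matrix.map_mul]
  have hu : (fun i => ∑ j, M.map (Polynomial.C : ℂ →+* Polynomial ℂ) j i * Polynomial.C (u j)) =
      fun i => Polynomial.C (∑ j, M j i * u j) := by
    funext i
    rw [map_sum]
    exact Finset.sum_congr rfl fun j _ => by rw [Matrix.map_apply, ← map_mul]
  have hv : (fun i => ∑ j, M.map (Polynomial.C : ℂ →+* Polynomial ℂ) j i * Polynomial.C (v j)) =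
      fun i => Polynomial.C (∑ j, M j i * v j) := by
    funext i
    rw [map_sum]
    exact Finset.sum_congr rfl fun j _ => by rw [Matrix.map_apply, ← map_mul]
  rw [hB, hu, hv]
  exact hπ.2 (B * M) _ _

/-- `GL(W)` form of `linSubst_mem_lmrZariskiTangent_of_linSubst_eq_smul`. [cite: LandsbergManivelRessayre2013, §3.4 (p. 478)] -/
theorem linSubstRep_mem_lmrZariskiTangent_of_linSubstRep_eq_smul [DecidableEq σ] {κ d : ℕ}
    {P π : MvPolynomial σ ℂ} (g : GL σ ℂ) {c : ℂ} (hc : c ≠ 0) (hg : linSubstRep σ ℂ g P = c • P)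
    (hπ : π ∈ lmrZariskiTangent κ d P) : linSubstRep σ ℂ g π ∈ lmrZariskiTangent κ d P := by
  rw [linSubstRep_apply] at hg ⊢
  exact linSubst_mem_lmrZariskiTangent_of_linSubst_eq_smul _ hc hg hπ

end Cone

end Literature.Computability.AlgebraicComplexity
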